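import Summits.QuantumFields.BalabanUV.Beta.GAN24.SpureRecSlotChargeThreeFace
import Summits.QuantumFields.BalabanUV.Beta.GAN24.CombKernelFaceResponse
import Summits.QuantumFields.BalabanUV.Beta.GAN24.SandwichReadoutTwoKernel
import Summits.QuantumFields.BalabanUV.Beta.GAN24.FaceWeightedSandwich
import Summits.QuantumFields.BalabanUV.Beta.GAN24.ExitFaceWeightTransport
import Summits.QuantumFields.BalabanUV.Beta.GAN24.CombVHEWordsZeroStep

/-!
# `BalabanUV.Beta.GAN24.ThreeFaceUnrollOfLocal` — binder row G-an2-4 ∕ (CONV-C), TRANSFER-III, the (III′) (C)-campaign's supplier `hB0` AT LEVELS `≥ 1`, the MEMBER-GENERIC twin of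
# leaf-04 g62's `ThreeFaceUnroll.threeFace_e3OfK_unroll` (the induction step of «3F-REC»): **THE THREE-FACE-LEGS CELL FORM OF THE CUBIC SECTOR `e3OfK Lc G_j S` OF ANY LOCAL,
# `Lc`-BLOCK-COVARIANT MEMBER `S` UNROLLS ONE LEVEL, PERIOD `P ↦ Lc·P`** — `3F^{(P)}[e3OfK Lc G_j S] = cH_j³ · 3F^{(Lc·P)}[S]`, `G_j = coDressKBmAt ρ Lc (KInvStep Lc j)`, in-block root.
# The original's proof uses of the member `SrecAt … j` ONLY its locality (`locStencil_SrecAt`) and block covariance (`SrecAt_translate`); here both are hypotheses, the proof is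
# otherwise leaf-04's VERBATIM.  WHY (leaf-01 g87 README-g87 §ROADMAP): the comb member is `𝒯 S̃comb_j` (local: C `exists_locStencil_transport_ScombOf`, block-covariant:
# C `transport_ScombOf_translate`), and with `ExitFaceWeightTransport.threeFace_transport_eq` the comb «3F-REC» step reads `3F^{(P)}[e3OfK Lc G^bm_j (𝒯 S̃comb_j)] = cH_j³·3F^{(Lc·P)}[S̃comb_j]`.
# (G-an2-4 CRUX TEAM (2), leaf prover `b2b-balaban-gan24-formalise-leaf-01`, gen 87)

NOT IN PRINT; OUR BOOKKEEPING ([folklore] Fubini ∕ periodisation bookkeeping BY NAME, leaf-04 g62's proof with the member abstracted; 0 `def`, 0 cited fact, 0 `def … : Prop`, 0 sorry).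
HONEST FRAMING (cell contract, verbatim): «discharging `BetaPertH` makes Bałaban's UV stability UNCONDITIONAL — a real constructive-QFT result; it is NOT the continuum limit and NOT
the Clay problem.»  HONEST DEPENDENCY (verbatim): «continuum YM on T⁴ ⇐ BetaPertH ∧ nine spine estimates (0/9 proved); BetaPertH ⇐ (D1) ∧ (D4) ∧ CAP+tail; G-an2-4 gates asym, D1
and NE2/3/4.»
WHAT: **`threeFace_e3OfK_unroll_of_local`** (generic `d`, `[NeZero Lc]`, `1 ≤ Lc`, in-block root, every `j`, every `P ≥ 1`, any local `Lc`-block-covariant `S`); **`threeFace_e3OfK_transport_ScombOf_unroll`**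
(the comb instance at an1's record: member `𝒯 S̃comb_j`, with the transport REMOVED on the right by `threeFace_transport_eq`).  Asserts NO value; NOT «3F-REC» at the comb (the Λ-piece and
level-0 letters for an1's sym tables are NOT here); NOT (Z)_comb; NOT `hB0`; NEVER «G-an2-4 closed» as (CONV-C); NOT D1, NOT `BetaPertH`, NOT continuum, NOT Clay.  2026-08-27; no existing file touched.
-/

noncomputable section

open Finset
open scoped BigOperators
open Literature.MathematicalPhysics.QuantumFieldTheory
open Literature.MathematicalPhysics.QuantumFieldTheory.Balaban1983to89
open Literature.MathematicalPhysics.QuantumFieldTheory.Balaban1983to89.Beta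
open B12Sec2to5 (l1 l1_nonneg)
open ExpKernelCalculus (Site MKer BiLoc Decays comp shiftK)
open AffineAveraging (box toSite)
open OneStepResolventKernel (Fib LocStencil)
open OneStepKernelFamily (KInvStep colH abs_colH_le vertexOfK vertexFamily_vertexOfK')
open BalabanStepJetsSucc (mmRead mmRead_inl_inl)
open Summit.QuantumFields.BalabanUV.Beta.AxialDressingRooted (coDressKBmAt decays_coDressKBmAt_KInvStep shiftK_coDressKBmAt_KInvStep)
open Summit.QuantumFields.BalabanUV.Beta.BorderedHessian (stepScale)
open Summit.QuantumFields.BalabanUV.Beta.SpineRooted (e3OfK e3OfK_apply)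
open Summit.QuantumFields.BalabanUV.Beta.GAN24.CombKernelFaceResponse (hasSum_colH_face hasSum_row_face hasSum_mm_col_face hasSum_mm_row_face)
open Summit.QuantumFields.BalabanUV.Beta.TameKernelCalculus (trK)
open AveragingContoursRooted (ctr ctrOff ctrOff_mem_box)
open Summit.QuantumFields.BalabanUV.Beta.SymCorrectorKernel (psiKS)
open Summit.QuantumFields.BalabanUV.Beta.SymCorrectorFace (slotPsiS)
open Summit.QuantumFields.BalabanUV.Beta.SymSecondOrderTablesAn1 (symTablesAn1S2)
open Summit.QuantumFields.BalabanUV.Beta.CombChartStepJets (ScombOf locStencil_ScombOf ScombOf_translate)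
open Summit.QuantumFields.BalabanUV.Beta.GAN24.CombTransportedBorder (pos_Lc)
open Summit.QuantumFields.BalabanUV.Beta.GAN24.CombVHEWordsZeroStep (exists_locStencil_transport_ScombOf transport_ScombOf_translate)
open Summit.QuantumFields.BalabanUV.Beta.GAN24.ExitFaceWeightTransport (threeFace_transport_eq)

namespace Summit.QuantumFields.BalabanUV.Beta.GAN24.ThreeFaceUnrollOfLocal

open Summit.QuantumFields.BalabanUV.Beta.GAN24.FaceWeightedSandwich (colH_block_shift emod_mul_eq_iff decays_ite_mul decays_mul_ite zsmul_apply_ediv comp_comp_weights)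

variable {d : ℕ} {Lc : ℕ} [NeZero Lc]

/-! ## §1 The member-generic unrolling identity -/

section Unroll

variable {r : Fin (d + 1) → ℕ}

/-- NOT IN PRINT; OUR BOOKKEEPING ([folklore]; leaf-04 g62's `threeFace_e3OfK_unroll` with the member abstracted).  For `G_j = coDressKBmAt ρ Lc (KInvStep Lc j)` (in-block root), ANY
local `Lc`-block-covariant `S`, every `P ≥ 1` and all `(γ, α, β)`:
`Σ_{v ∈ box P} [v_γ % P = P−1]·Σ'_{(y,w)} [y_α % P = P−1][w_β % P = P−1]·e3OfK Lc G_j S γ v y w (inl α)(inl β)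
   = cH_j³ · Σ_{τ ∈ box (Lc·P)} [τ_γ % LcP = LcP−1]·Σ'_{(s,t)} [s_α % LcP = LcP−1][t_β % LcP = LcP−1]·S γ τ s t (inl α)(inl β)`, `cH_j = (stepScale d Lc j · Lc^{d+1})⁻¹`. -/
theorem threeFace_e3OfK_unroll_of_local (hLc : 1 ≤ Lc) (hr : r ∈ box (d + 1) Lc) {S : Fin (d + 1) → Site (d + 1) → MKer (d + 1) (Fib d)} {Cs δs : ℝ}
    (hSl : LocStencil S Cs δs) (hδs : 0 < δs) (hScov : ∀ (κ : Fin (d + 1)) (u t : Site (d + 1)), S κ (u + (Lc : ℤ) • t) = shiftK (-((Lc : ℤ) • t)) (S κ u))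
    (j : ℕ) (γ α β : Fin (d + 1)) (P : ℕ) [NeZero P] :
    (∑ v ∈ box (d + 1) P, (if toSite v γ % (P : ℤ) = (P : ℤ) - 1 then (1 : ℝ) else 0) *
        ∑' yw : Site (d + 1) × Site (d + 1),
          (if yw.1 α % (P : ℤ) = (P : ℤ) - 1 then (1 : ℝ) else 0) * (if yw.2 β % (P : ℤ) = (P : ℤ) - 1 then (1 : ℝ) else 0) *
            e3OfK Lc (coDressKBmAt (toSite r) Lc (KInvStep (d := d) Lc j)) S γ (toSite v) yw.1 yw.2 (Sum.inl α) (Sum.inl β))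
      = ((stepScale d Lc j * (Lc : ℝ) ^ (d + 1))⁻¹) ^ 3 *
        ∑ τ ∈ box (d + 1) (Lc * P), (if toSite τ γ % ((Lc * P : ℕ) : ℤ) = ((Lc * P : ℕ) : ℤ) - 1 then (1 : ℝ) else 0) *
          ∑' st : Site (d + 1) × Site (d + 1),
            (if st.1 α % ((Lc * P : ℕ) : ℤ) = ((Lc * P : ℕ) : ℤ) - 1 then (1 : ℝ) else 0) *
              (if st.2 β % ((Lc * P : ℕ) : ℤ) = ((Lc * P : ℕ) : ℤ) - 1 then (1 : ℝ) else 0) *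
              S γ (toSite τ) st.1 st.2 (Sum.inl α) (Sum.inl β) := by
  set G : MKer (d + 1) (Fib d) := coDressKBmAt (toSite r) Lc (KInvStep (d := d) Lc j) with hG
  set cH : ℝ := (stepScale d Lc j * (Lc : ℝ) ^ (d + 1))⁻¹ with hcH
  have hLc0 : (0 : ℤ) < (Lc : ℤ) := by exact_mod_cast hLc
  have hP0 : (0 : ℤ) < (P : ℤ) := by exact_mod_cast Nat.pos_of_ne_zero (NeZero.ne P)
  haveI : NeZero (Lc * P) := ⟨Nat.mul_ne_zero (NeZero.ne Lc) (NeZero.ne P)⟩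
  have hLP : ((Lc * P : ℕ) : ℤ) = (Lc : ℤ) * (P : ℤ) := by push_cast; ring
  -- face indicators: coarse (period P) and fine two-scale (period Lc in the digit, P in the block index)
  set wP : Fin (d + 1) → Site (d + 1) → ℝ := fun a y => if y a % (P : ℤ) = (P : ℤ) - 1 then 1 else 0 with hwP
  set f2 : Fin (d + 1) → Site (d + 1) → ℝ := fun a y =>
    (if y a % (Lc : ℤ) = (Lc : ℤ) - 1 then (1 : ℝ) else 0) * (if (y a / (Lc : ℤ)) % (P : ℤ) = (P : ℤ) - 1 then (1 : ℝ) else 0) with hf2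
  have hf2_eq : ∀ (a : Fin (d + 1)) (y : Site (d + 1)),
      f2 a y = if y a % ((Lc * P : ℕ) : ℤ) = ((Lc * P : ℕ) : ℤ) - 1 then (1 : ℝ) else 0 := by
    intro a y
    simp only [hf2, hLP]
    by_cases h : y a % ((Lc : ℤ) * (P : ℤ)) = (Lc : ℤ) * (P : ℤ) - 1
    · obtain ⟨h1, h2⟩ := (emod_mul_eq_iff hLc0 hP0 (y a)).1 h
      simp [h, h1, h2]
    · have h' : ¬ (y a % (Lc : ℤ) = (Lc : ℤ) - 1 ∧ (y a / (Lc : ℤ)) % (P : ℤ) = (P : ℤ) - 1) := fun hh => h ((emod_mul_eq_iff hLc0 hP0 (y a)).2 hh)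
      by_cases h1 : y a % (Lc : ℤ) = (Lc : ℤ) - 1
      · have h2 : ¬ ((y a / (Lc : ℤ)) % (P : ℤ) = (P : ℤ) - 1) := fun hh => h' ⟨h1, hh⟩
        simp [h, h1, h2]
      · simp [h, h1]
  have hf2b : ∀ a y, |f2 a y| ≤ 1 := by
    intro a y; simp only [hf2]; split_ifs <;> simp
  -- decay ∕ localisation data
  obtain ⟨δG, CG, hδG, hCG, hGd⟩ := decays_coDressKBmAt_KInvStep (d := d) hr j
  obtain ⟨Cv, δv, hδv, hVF⟩ := vertexFamily_vertexOfK' (N := Lc) ⟨δG, CG, hδG, hCG, hGd⟩ hSl hδs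
  have hGs : ∀ t : Site (d + 1), shiftK (-((Lc : ℤ) • t)) G = G := fun t => shiftK_coDressKBmAt_KInvStep (d := d) (toSite r) j t
  have hSt : ∀ (κ : Fin (d + 1)) (u t : Site (d + 1)), S κ (u + ((Lc * P : ℕ) : ℤ) • t) = shiftK (-(((Lc * P : ℕ) : ℤ) • t)) (S κ u) := by
    intro κ u t
    have h := hScov κ u ((P : ℤ) • t)
    have e : (Lc : ℤ) • ((P : ℤ) • t) = ((Lc * P : ℕ) : ℤ) • t := by rw [hLP, mul_smul]
    rw [e] at h
    exact h
  -- the two face-weighted outer kernels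
  set KL : MKer (d + 1) (Fib d) := fun x y a b => (if (x α / (Lc : ℤ)) % (P : ℤ) = (P : ℤ) - 1 then (1 : ℝ) else 0) * G x y a b with hKL
  set KR : MKer (d + 1) (Fib d) := fun x y a b => G x y a b * (if (y β / (Lc : ℤ)) % (P : ℤ) = (P : ℤ) - 1 then (1 : ℝ) else 0) with hKR
  have hKLd : Decays KL CG δG := decays_ite_mul hGd (fun x => (x α / (Lc : ℤ)) % (P : ℤ) = (P : ℤ) - 1)
  have hKRd : Decays KR CG δG := decays_mul_ite hGd (fun y => (y β / (Lc : ℤ)) % (P : ℤ) = (P : ℤ) - 1)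
  -- their coarse-leg charges (the face laws of `CombKernelFaceResponse`)
  have hrow : ∀ (f : Fib d) (s : Site (d + 1)), HasSum (fun x' : Site (d + 1) => KL ((Lc : ℤ) • x') s (Sum.inr α) f)
      (Sum.elim (fun a => -((stepScale d Lc j * (Lc : ℝ) ^ (d + 1))⁻¹ * ((if a = α then (1 : ℝ) else 0) *
        (if s α % (Lc : ℤ) = (Lc : ℤ) - 1 then (1 : ℝ) else 0) * (if (s α / (Lc : ℤ)) % (P : ℤ) = (P : ℤ) - 1 then (1 : ℝ) else 0))))
        (fun _ => (0 : ℝ)) f) := by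
    intro f s
    rcases f with a | m
    · have h := hasSum_row_face hr j α a s P
      have ef : (fun x' : Site (d + 1) => KL ((Lc : ℤ) • x') s (Sum.inr α) (Sum.inl a))
          = fun x'' => if x'' α % (P : ℤ) = (P : ℤ) - 1 then
              coDressKBmAt (toSite r) Lc (KInvStep (d := d) Lc j) ((Lc : ℤ) • x'') s (Sum.inr α) (Sum.inl a) else 0 := by
        funext x'
        simp only [hKL, zsmul_apply_ediv]
        split_ifs <;> simp [hG]
      rw [ef]; exact h
    · have h := hasSum_mm_row_face hr j s α m P
      have ef : (fun x' : Site (d + 1) => KL ((Lc : ℤ) • x') s (Sum.inr α) (Sum.inr m))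
          = fun x'' => if x'' α % (P : ℤ) = (P : ℤ) - 1 then
              coDressKBmAt (toSite r) Lc (KInvStep (d := d) Lc j) ((Lc : ℤ) • x'') s (Sum.inr α) (Sum.inr m) else 0 := by
        funext x'
        simp only [hKL, zsmul_apply_ediv]
        split_ifs <;> simp [hG]
      rw [ef]; exact h
  have hcol : ∀ (g : Fib d) (w : Site (d + 1)), HasSum (fun z' : Site (d + 1) => KR w ((Lc : ℤ) • z') g (Sum.inr β))
      (Sum.elim (fun b => (stepScale d Lc j * (Lc : ℝ) ^ (d + 1))⁻¹ * ((if b = β then (1 : ℝ) else 0) *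
        (if w β % (Lc : ℤ) = (Lc : ℤ) - 1 then (1 : ℝ) else 0) * (if (w β / (Lc : ℤ)) % (P : ℤ) = (P : ℤ) - 1 then (1 : ℝ) else 0)))
        (fun _ => (0 : ℝ)) g) := by
    intro g w
    rcases g with b | m
    · have h := hasSum_colH_face hr j β b w P
      have ef : (fun z' : Site (d + 1) => KR w ((Lc : ℤ) • z') (Sum.inl b) (Sum.inr β))
          = fun y => if y β % (P : ℤ) = (P : ℤ) - 1 then colH (coDressKBmAt (toSite r) Lc (KInvStep (d := d) Lc j)) Lc β y b w else 0 := by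
        funext z'
        simp only [hKR, zsmul_apply_ediv, colH]
        split_ifs <;> simp [hG]
      rw [ef]; exact h
    · have h := hasSum_mm_col_face hr j w m β P
      have ef : (fun z' : Site (d + 1) => KR w ((Lc : ℤ) • z') (Sum.inr m) (Sum.inr β))
          = fun y => if y β % (P : ℤ) = (P : ℤ) - 1 then
              coDressKBmAt (toSite r) Lc (KInvStep (d := d) Lc j) w ((Lc : ℤ) • y) (Sum.inr m) (Sum.inr β) else 0 := by
        funext z'
        simp only [hKR, zsmul_apply_ediv]
        split_ifs <;> simp [hG]
      rw [ef]; exact h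
  -- (C′) the weighted-vertex Fubini data
  have hw : ∀ (v : Fin (d + 1) → ℕ) (κ : Fin (d + 1)) (t : Site (d + 1)),
      |colH G Lc γ (toSite v) κ t| ≤ CG * Real.exp (-δG * l1 (t - (Lc : ℤ) • toSite v)) :=
    fun v κ t => abs_colH_le (N := Lc) hGd γ (toSite v) κ t
  set ω : Site (d + 1) × Site (d + 1) → ℝ := fun yw => (-(cH * f2 α yw.1)) * (cH * f2 β yw.2) with hω
  have hcH0 : 0 ≤ cH := by rw [hcH]; exact inv_nonneg.2 (by unfold stepScale; positivity)
  have hωb : ∀ yw : Site (d + 1) × Site (d + 1), |ω yw| ≤ cH * cH := by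
    intro yw
    show |(-(cH * f2 α yw.1)) * (cH * f2 β yw.2)| ≤ cH * cH
    have e1 : |(-(cH * f2 α yw.1))| ≤ cH := by
      rw [abs_neg, abs_mul (cH) (f2 α yw.1), abs_of_nonneg hcH0]
      have h := mul_le_mul_of_nonneg_left (hf2b α yw.1) hcH0
      rwa [mul_one] at h
    have e2 : |cH * f2 β yw.2| ≤ cH := by
      rw [abs_mul (cH) (f2 β yw.2), abs_of_nonneg hcH0]
      have h := mul_le_mul_of_nonneg_left (hf2b β yw.2) hcH0
      rwa [mul_one] at h
    rw [abs_mul (-(cH * f2 α yw.1)) (cH * f2 β yw.2)]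
    exact mul_le_mul e1 e2 (abs_nonneg _) hcH0
  have hωp : ∀ (yw : Site (d + 1) × Site (d + 1)) (t : Site (d + 1)),
      ω (yw.1 + ((Lc * P : ℕ) : ℤ) • t, yw.2 + ((Lc * P : ℕ) : ℤ) • t) = ω yw := by
    intro yw t
    simp only [hω, hf2_eq, SpureRecSlotChargeThreeFace.face_periodic]
  -- per slot: the pair sum in closed form
  have hslot : ∀ v : Fin (d + 1) → ℕ,
      HasSum (fun yw : Site (d + 1) × Site (d + 1) =>
          (if yw.1 α % (P : ℤ) = (P : ℤ) - 1 then (1 : ℝ) else 0) * (if yw.2 β % (P : ℤ) = (P : ℤ) - 1 then (1 : ℝ) else 0) *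
            e3OfK Lc G S γ (toSite v) yw.1 yw.2 (Sum.inl α) (Sum.inl β))
        (-(∑ κ : Fin (d + 1), ∑' t : Site (d + 1), colH G Lc γ (toSite v) κ t *
            ∑' yw : Site (d + 1) × Site (d + 1), ω yw * S κ t yw.1 yw.2 (Sum.inl α) (Sum.inl β))) := by
    intro v
    have hVb : BiLoc (vertexOfK G Lc S γ (toSite v)) ((Lc : ℤ) • toSite v) ((Lc : ℤ) • toSite v) Cv δv := hVF γ (toSite v)
    -- (A) the two-kernel sandwich read-out
    have hsand := SandwichReadoutTwoKernel.hasSum_sandwich_readout_dep₂ (N := Lc) hKLd hKRd hδG hVb hδv α β hrow hcol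
    -- (B) collapse of the fibre sums
    have hcoll : ∀ yw : Site (d + 1) × Site (d + 1),
        (∑ f : Fib d, ∑ g : Fib d,
          Sum.elim (fun a => -((stepScale d Lc j * (Lc : ℝ) ^ (d + 1))⁻¹ * ((if a = α then (1 : ℝ) else 0) *
            (if yw.1 α % (Lc : ℤ) = (Lc : ℤ) - 1 then (1 : ℝ) else 0) * (if (yw.1 α / (Lc : ℤ)) % (P : ℤ) = (P : ℤ) - 1 then (1 : ℝ) else 0))))
            (fun _ => (0 : ℝ)) f *
          vertexOfK G Lc S γ (toSite v) yw.1 yw.2 f g *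
          Sum.elim (fun b => (stepScale d Lc j * (Lc : ℝ) ^ (d + 1))⁻¹ * ((if b = β then (1 : ℝ) else 0) *
            (if yw.2 β % (Lc : ℤ) = (Lc : ℤ) - 1 then (1 : ℝ) else 0) * (if (yw.2 β / (Lc : ℤ)) % (P : ℤ) = (P : ℤ) - 1 then (1 : ℝ) else 0)))
            (fun _ => (0 : ℝ)) g)
          = ω yw * vertexOfK G Lc S γ (toSite v) yw.1 yw.2 (Sum.inl α) (Sum.inl β) := by
      intro yw
      rw [Fintype.sum_sum_type]
      simp only [Fintype.sum_sum_type, Sum.elim_inl, Sum.elim_inr, mul_zero, zero_mul, Finset.sum_const_zero, add_zero]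
      rw [Finset.sum_eq_single α]
      · rw [Finset.sum_eq_single β]
        · simp only [if_true, one_mul, hω, hf2, hcH]; ring
        · intro b _ hb; simp only [hb, if_false, zero_mul, mul_zero]
        · intro h; exact absurd (Finset.mem_univ β) h
      · intro a _ ha
        refine Finset.sum_eq_zero fun b _ => ?_
        simp only [ha, if_false, zero_mul, mul_zero, neg_zero]
      · intro h; exact absurd (Finset.mem_univ α) h
    have hvert := WardResidualRotatedVertexWeighted.hasSum_weighted_vertexOfK (N := Lc) (K' := G) γ (toSite v) (hw v) hδG hSl hδs
      (Sum.inl α) (Sum.inl β) (ω := ω) hωb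
    have hpt : ∀ yw : Site (d + 1) × Site (d + 1),
        (if yw.1 α % (P : ℤ) = (P : ℤ) - 1 then (1 : ℝ) else 0) * (if yw.2 β % (P : ℤ) = (P : ℤ) - 1 then (1 : ℝ) else 0) *
            e3OfK Lc G S γ (toSite v) yw.1 yw.2 (Sum.inl α) (Sum.inl β)
          = -(comp (comp KL (vertexOfK G Lc S γ (toSite v))) KR ((Lc : ℤ) • yw.1) ((Lc : ℤ) • yw.2) (Sum.inr α) (Sum.inr β)) := by
      intro yw
      rw [hKL, hKR, comp_comp_weights, zsmul_apply_ediv, zsmul_apply_ediv, e3OfK_apply, mmRead_inl_inl]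
      ring
    have hval : (∑' yw : Site (d + 1) × Site (d + 1), ∑ f : Fib d, ∑ g : Fib d,
          Sum.elim (fun a => -((stepScale d Lc j * (Lc : ℝ) ^ (d + 1))⁻¹ * ((if a = α then (1 : ℝ) else 0) *
            (if yw.1 α % (Lc : ℤ) = (Lc : ℤ) - 1 then (1 : ℝ) else 0) * (if (yw.1 α / (Lc : ℤ)) % (P : ℤ) = (P : ℤ) - 1 then (1 : ℝ) else 0))))
            (fun _ => (0 : ℝ)) f *
          vertexOfK G Lc S γ (toSite v) yw.1 yw.2 f g *
          Sum.elim (fun b => (stepScale d Lc j * (Lc : ℝ) ^ (d + 1))⁻¹ * ((if b = β then (1 : ℝ) else 0) *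
            (if yw.2 β % (Lc : ℤ) = (Lc : ℤ) - 1 then (1 : ℝ) else 0) * (if (yw.2 β / (Lc : ℤ)) % (P : ℤ) = (P : ℤ) - 1 then (1 : ℝ) else 0)))
            (fun _ => (0 : ℝ)) g)
        = ∑ κ : Fin (d + 1), ∑' t : Site (d + 1), colH G Lc γ (toSite v) κ t *
            ∑' yw : Site (d + 1) × Site (d + 1), ω yw * S κ t yw.1 yw.2 (Sum.inl α) (Sum.inl β) := by
      rw [tsum_congr hcoll, hvert.1.tsum_eq]
    have hfin := hsand.neg
    rw [hval] at hfin
    exact hfin.congr_fun fun yw => (hpt yw).symm ▸ rfl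
  -- periodicity of the slot function and periodisation at period `Lc·P`
  have hg : ∀ (κ : Fin (d + 1)) (u t : Site (d + 1)),
      (∑' yw : Site (d + 1) × Site (d + 1), ω yw * S κ (u + ((Lc * P : ℕ) : ℤ) • t) yw.1 yw.2 (Sum.inl α) (Sum.inl β))
        = ∑' yw : Site (d + 1) × Site (d + 1), ω yw * S κ u yw.1 yw.2 (Sum.inl α) (Sum.inl β) :=
    fun κ u t => SpureRecSlotChargeThreeFace.tsum_weighted_periodic (N := Lc * P) hSt hωp κ u t (Sum.inl α) (Sum.inl β)
  have hsumm : ∀ (v : Fin (d + 1) → ℕ) (κ : Fin (d + 1)), Summable fun t : Site (d + 1) =>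
      colH G Lc γ (toSite v) κ t * ∑' yw : Site (d + 1) × Site (d + 1), ω yw * S κ t yw.1 yw.2 (Sum.inl α) (Sum.inl β) :=
    fun v κ => (WardResidualRotatedVertexWeighted.hasSum_weighted_vertexOfK (N := Lc) (K' := G) γ (toSite v) (hw v) hδG hSl hδs
      (Sum.inl α) (Sum.inl β) (ω := ω) hωb).2 κ
  have hper : ∀ (v : Fin (d + 1) → ℕ) (κ : Fin (d + 1)),
      (∑' t : Site (d + 1), colH G Lc γ (toSite v) κ t * ∑' yw : Site (d + 1) × Site (d + 1), ω yw * S κ t yw.1 yw.2 (Sum.inl α) (Sum.inl β))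
        = ∑ τ ∈ box (d + 1) (Lc * P), (∑' yw : Site (d + 1) × Site (d + 1), ω yw * S κ (toSite τ) yw.1 yw.2 (Sum.inl α) (Sum.inl β)) *
            ∑' t : Site (d + 1), colH G Lc γ (toSite v) κ (((Lc * P : ℕ) : ℤ) • t + toSite τ) := by
    intro v κ
    exact BiStencilZeroMode.tsum_mul_periodic (N := Lc * P) (fun u t => hg κ u t) (hsumm v κ)
  -- the coset column sums against the slot face: the face law again
  have hcoset : ∀ (κ : Fin (d + 1)) (τ : Fin (d + 1) → ℕ),
      (∑ v ∈ box (d + 1) P, wP γ (toSite v) * ∑' t : Site (d + 1), colH G Lc γ (toSite v) κ (((Lc * P : ℕ) : ℤ) • t + toSite τ))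
        = cH * ((if κ = γ then (1 : ℝ) else 0) * f2 γ (toSite τ)) := by
    intro κ τ
    -- the summable family `x ↦ wP(x)·colH G γ x κ τ` and its cell decomposition at period `P`
    have hφs : Summable fun x : Site (d + 1) => wP γ x * colH G Lc γ x κ (toSite τ) := by
      refine Summable.of_norm_bounded (CombKernelSheetResponse.summable_colH_comb hr j γ κ (toSite τ)).norm fun x => ?_
      rw [Real.norm_eq_abs, abs_mul, Real.norm_eq_abs]
      have : |wP γ x| ≤ 1 := by simp only [hwP]; split_ifs <;> simp
      nlinarith [abs_nonneg (colH G Lc γ x κ (toSite τ)), abs_nonneg (wP γ x)]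
    have hface := (hasSum_colH_face hr j γ κ (toSite τ) P).tsum_eq
    have eφ : (fun x : Site (d + 1) => if x γ % (P : ℤ) = (P : ℤ) - 1 then colH G Lc γ x κ (toSite τ) else 0)
        = fun x => wP γ x * colH G Lc γ x κ (toSite τ) := by
      funext x; simp only [hwP]; split_ifs <;> simp
    rw [eφ, BiStencilZeroMode.tsum_eq_sum_box_tsum (N := P) hφs] at hface
    rw [show cH * ((if κ = γ then (1 : ℝ) else 0) * f2 γ (toSite τ))
        = (stepScale d Lc j * (Lc : ℝ) ^ (d + 1))⁻¹ * ((if κ = γ then (1 : ℝ) else 0) *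
          (if toSite τ γ % (Lc : ℤ) = (Lc : ℤ) - 1 then (1 : ℝ) else 0) * (if toSite τ γ / (Lc : ℤ) % (P : ℤ) = (P : ℤ) - 1 then (1 : ℝ) else 0)) by
        simp only [hcH, hf2]; ring]
    rw [← hface]
    refine Finset.sum_congr rfl fun v _ => ?_
    rw [← tsum_mul_left]
    rw [← (Equiv.neg (Site (d + 1))).tsum_eq (fun t : Site (d + 1) => wP γ ((P : ℤ) • t + toSite v) * colH G Lc γ ((P : ℤ) • t + toSite v) κ (toSite τ))]
    refine tsum_congr fun t => ?_
    simp only [Equiv.neg_apply]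
    have e1 : ((Lc * P : ℕ) : ℤ) • t + toSite τ = (Lc : ℤ) • ((P : ℤ) • t) + toSite τ := by rw [hLP, mul_smul]
    rw [e1, colH_block_shift hGs]
    have e2 : toSite v - (P : ℤ) • t = (P : ℤ) • (-t) + toSite v := by rw [smul_neg]; abel
    rw [e2]
    congr 1
    have hc : (((P : ℤ) • -t + toSite v) γ) % (P : ℤ) = toSite v γ % (P : ℤ) := by
      simp only [Pi.add_apply, Pi.smul_apply, smul_eq_mul]
      rw [add_comm, Int.add_mul_emod_self_left]
    simp only [hwP, hc]
  -- assembly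
  have hLHS : ∀ v : Fin (d + 1) → ℕ,
      (∑' yw : Site (d + 1) × Site (d + 1),
          (if yw.1 α % (P : ℤ) = (P : ℤ) - 1 then (1 : ℝ) else 0) * (if yw.2 β % (P : ℤ) = (P : ℤ) - 1 then (1 : ℝ) else 0) *
            e3OfK Lc G S γ (toSite v) yw.1 yw.2 (Sum.inl α) (Sum.inl β))
        = -(∑ κ : Fin (d + 1), ∑ τ ∈ box (d + 1) (Lc * P),
            (∑' yw : Site (d + 1) × Site (d + 1), ω yw * S κ (toSite τ) yw.1 yw.2 (Sum.inl α) (Sum.inl β)) *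
              ∑' t : Site (d + 1), colH G Lc γ (toSite v) κ (((Lc * P : ℕ) : ℤ) • t + toSite τ)) := by
    intro v
    rw [(hslot v).tsum_eq]
    congr 1
    exact Finset.sum_congr rfl fun κ _ => hper v κ
  have hgval : ∀ (τ : Fin (d + 1) → ℕ),
      (∑' yw : Site (d + 1) × Site (d + 1), ω yw * S γ (toSite τ) yw.1 yw.2 (Sum.inl α) (Sum.inl β))
        = -(cH * cH) * ∑' st : Site (d + 1) × Site (d + 1),
            (if st.1 α % ((Lc * P : ℕ) : ℤ) = ((Lc * P : ℕ) : ℤ) - 1 then (1 : ℝ) else 0) *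
              (if st.2 β % ((Lc * P : ℕ) : ℤ) = ((Lc * P : ℕ) : ℤ) - 1 then (1 : ℝ) else 0) *
              S γ (toSite τ) st.1 st.2 (Sum.inl α) (Sum.inl β) := by
    intro τ
    rw [← tsum_mul_left]
    refine tsum_congr fun yw => ?_
    simp only [hω, hf2_eq]
    ring
  calc (∑ v ∈ box (d + 1) P, (if toSite v γ % (P : ℤ) = (P : ℤ) - 1 then (1 : ℝ) else 0) *
        ∑' yw : Site (d + 1) × Site (d + 1),
          (if yw.1 α % (P : ℤ) = (P : ℤ) - 1 then (1 : ℝ) else 0) * (if yw.2 β % (P : ℤ) = (P : ℤ) - 1 then (1 : ℝ) else 0) *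
            e3OfK Lc G S γ (toSite v) yw.1 yw.2 (Sum.inl α) (Sum.inl β))
      = ∑ v ∈ box (d + 1) P, wP γ (toSite v) * -(∑ κ : Fin (d + 1), ∑ τ ∈ box (d + 1) (Lc * P),
            (∑' yw : Site (d + 1) × Site (d + 1), ω yw * S κ (toSite τ) yw.1 yw.2 (Sum.inl α) (Sum.inl β)) *
              ∑' t : Site (d + 1), colH G Lc γ (toSite v) κ (((Lc * P : ℕ) : ℤ) • t + toSite τ)) := by
        refine Finset.sum_congr rfl fun v _ => ?_
        rw [hLHS v]
    _ = -(∑ κ : Fin (d + 1), ∑ τ ∈ box (d + 1) (Lc * P),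
          (∑' yw : Site (d + 1) × Site (d + 1), ω yw * S κ (toSite τ) yw.1 yw.2 (Sum.inl α) (Sum.inl β)) *
            (∑ v ∈ box (d + 1) P, wP γ (toSite v) * ∑' t : Site (d + 1), colH G Lc γ (toSite v) κ (((Lc * P : ℕ) : ℤ) • t + toSite τ))) := by
        simp only [mul_neg, Finset.sum_neg_distrib, Finset.mul_sum]
        congr 1
        rw [Finset.sum_comm]
        refine Finset.sum_congr rfl fun κ _ => ?_
        rw [Finset.sum_comm]
        refine Finset.sum_congr rfl fun τ _ => Finset.sum_congr rfl fun v _ => ?_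
        ring
    _ = -(∑ κ : Fin (d + 1), ∑ τ ∈ box (d + 1) (Lc * P),
          (∑' yw : Site (d + 1) × Site (d + 1), ω yw * S κ (toSite τ) yw.1 yw.2 (Sum.inl α) (Sum.inl β)) *
            (cH * ((if κ = γ then (1 : ℝ) else 0) * f2 γ (toSite τ)))) := by
        congr 1
        refine Finset.sum_congr rfl fun κ _ => Finset.sum_congr rfl fun τ _ => ?_
        rw [hcoset κ τ]
    _ = -(∑ τ ∈ box (d + 1) (Lc * P),
          (∑' yw : Site (d + 1) × Site (d + 1), ω yw * S γ (toSite τ) yw.1 yw.2 (Sum.inl α) (Sum.inl β)) * (cH * f2 γ (toSite τ))) := by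
        congr 1
        rw [Finset.sum_eq_single γ]
        · simp only [if_true, one_mul]
        · intro κ _ hκ
          refine Finset.sum_eq_zero fun τ _ => ?_
          simp only [hκ, if_false, zero_mul, mul_zero]
        · intro h; exact absurd (Finset.mem_univ γ) h
    _ = _ := by
        rw [Finset.mul_sum, ← Finset.sum_neg_distrib]
        refine Finset.sum_congr rfl fun τ _ => ?_
        rw [hgval τ, hf2_eq]
        ring

end Unroll

/-! ## §2 The comb instance: the transported member, the transport removed on the right -/

section Comb

/-- NOT IN PRINT; OUR BOOKKEEPING ([folklore]; THE COMB «3F-REC» E-STEP).  At an1's record `symTablesAn1S2 d Lc cΛt`, comb root, ALL pins, every `j`, every `P ≥ 1`, all `(γ, α, β)`: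
the three-face-legs cell form (period `P`) of the comb E-sector kernel `e3OfK Lc G^bm_j (𝒯 S̃comb_j)` equals `cH_j³ ×` the three-face-legs cell form (period `Lc·P`) of the
UNTRANSPORTED member `S̃comb_j = ScombOf tabs cE cVH cΛ j` — §1 on the local block-covariant member `𝒯 S̃comb_j` (C §3), then `ExitFaceWeightTransport.threeFace_transport_eq`. -/
theorem threeFace_e3OfK_transport_ScombOf_unroll (cΛt cE cVH cΛ : ℝ) (j : ℕ) (γ α β : Fin (d + 1)) (P : ℕ) [NeZero P] :
    (∑ v ∈ box (d + 1) P, (if toSite v γ % (P : ℤ) = (P : ℤ) - 1 then (1 : ℝ) else 0) *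
        ∑' yw : Site (d + 1) × Site (d + 1),
          (if yw.1 α % (P : ℤ) = (P : ℤ) - 1 then (1 : ℝ) else 0) * (if yw.2 β % (P : ℤ) = (P : ℤ) - 1 then (1 : ℝ) else 0) *
            e3OfK Lc (coDressKBmAt (ctr (d + 1) Lc) Lc (KInvStep (d := d) Lc j))
              (fun κ u => comp (comp (trK (psiKS (ctrOff (d + 1) Lc) Lc)) (slotPsiS (ctrOff (d + 1) Lc) Lc (ScombOf (symTablesAn1S2 d Lc cΛt) cE cVH cΛ j) κ u))
                (psiKS (ctrOff (d + 1) Lc) Lc)) γ (toSite v) yw.1 yw.2 (Sum.inl α) (Sum.inl β))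
      = ((stepScale d Lc j * (Lc : ℝ) ^ (d + 1))⁻¹) ^ 3 *
        ∑ τ ∈ box (d + 1) (Lc * P), (if toSite τ γ % ((Lc * P : ℕ) : ℤ) = ((Lc * P : ℕ) : ℤ) - 1 then (1 : ℝ) else 0) *
          ∑' st : Site (d + 1) × Site (d + 1),
            (if st.1 α % ((Lc * P : ℕ) : ℤ) = ((Lc * P : ℕ) : ℤ) - 1 then (1 : ℝ) else 0) *
              (if st.2 β % ((Lc * P : ℕ) : ℤ) = ((Lc * P : ℕ) : ℤ) - 1 then (1 : ℝ) else 0) *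
              ScombOf (symTablesAn1S2 d Lc cΛt) cE cVH cΛ j γ (toSite τ) st.1 st.2 (Sum.inl α) (Sum.inl β) := by
  have hLc : 1 ≤ Lc := Nat.one_le_iff_ne_zero.mpr (NeZero.ne Lc)
  have hr : ctrOff (d + 1) Lc ∈ box (d + 1) Lc := ctrOff_mem_box (pos_Lc (Lc := Lc))
  obtain ⟨CM, δM, hδM, hM⟩ := exists_locStencil_transport_ScombOf (d := d) (Lc := Lc) cΛt cE cVH cΛ j
  obtain ⟨Cs, δs, hδs, hS⟩ := locStencil_ScombOf (symTablesAn1S2 d Lc cΛt) cE cVH cΛ j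
  have h1 := threeFace_e3OfK_unroll_of_local (d := d) hLc hr hM hδM (fun κ u t => transport_ScombOf_translate (d := d) (Lc := Lc) cΛt cE cVH cΛ j κ u t) j γ α β P
  have h2 := threeFace_transport_eq (pos_Lc (Lc := Lc)) hr hS hδs P γ α β
  rw [h2] at h1
  exact h1

end Comb

end Summit.QuantumFields.BalabanUV.Beta.GAN24.ThreeFaceUnrollOfLocal

end
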